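import Summits.Ventures.QEDPrecision.SpectralMajorants.J4Moments
import Literature.Analysis.TotalPositivity.PolyaFrequencyZeros
import Mathlib.Analysis.SpecialFunctions.Log.Deriv
import HarnessLib

/-!
# The Källén–Sabry inner integral `J₄` as a power series in `w = z/(2−z)`, and its majorant `𝒥`
(venture QEDPrecision, cell `pub-qed`, literature seat, gen 13; folder `SpectralMajorants/`, file 3b)

HONEST FRAMING (verbatim, venture QEDPrecision): independent recomputation; certified where stated,
statistical where stated; no new-physics claim.

## What this file is

§2.1/§2.4 of the I(b)/I(c) certificate's premise note `certs/SetIbIc/repr/gl_bounds.md` as KERNEL theorems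
(continuing file 3a `J4Moments`, which proves `J₄(x) = Σ_j m_j w^{2j+2}` on `(0,1)`):

* the complex extension `jC z := w(z)² · Σ_j m_j (w(z)²)^j`, `w(z) = z/(2−z)` (`moebW`), with
  `jC_ofReal : jC x = ∫₀¹ ρ₄(t)/W_t(x) dt` (`0 < x < 1`) and `differentiableOn_jC` on the open unit disc
  (there `‖w‖ < 1`; power series via `Literature.Analysis.TotalPositivity.hasFPowerSeriesOnBall_of_hasSum`);
* the majorant of §2.4, `norm_jC_le` : `‖z‖ ≤ r < 1 ⇒ ‖jC z‖ ≤ 𝒥(r)`,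
  `𝒥(r) := jMaj r = 19·u·½(ln(1+u) − ln(1−u))`, `u = r/(2−r)` (= `Γ·u·atanh u` of the note;
  "`|J₄(z)| ≤ Γ Σ_{j≥0} |w|^{2j+2}/(2j+1) = Γ|w|·atanh|w|`, `|w| ≤ r/(2−r)`"), and the real corollary
  `abs_integral_rho4_div_wt_le_jMaj`.

NEW WORK of the cell (elementary analysis about the cell's typed objects), not a published result; nothing
here is cited as a fact anywhere; no numerical value of any anomaly integral is asserted.  Not an R-row.
-/

noncomputable section

open Real Set MeasureTheory intervalIntegral

namespace Summit.Ventures.QEDPrecision.SpectralMajorants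

open Literature.MathematicalPhysics.QuantumFieldTheory.Jegerlehner2017

/-! ### The complex extension as a power series in `w²` -/

/-- `Σ_j m_j uʲ` (the series of `J₄` in `u = w²`). -/
def jS (u : ℂ) : ℂ := ∑' j : ℕ, (ksMoment j : ℂ) * u ^ j

/-- The Möbius coordinate `w(z) = z/(2−z)` of the note (§2.4). -/
def moebW (z : ℂ) : ℂ := z / (2 - z)

/-- The complex extension of `J₄`: `jC z = w(z)²·Σ_j m_j (w(z)²)ʲ = Σ_j m_j w^{2j+2}`. -/
def jC (z : ℂ) : ℂ := moebW z ^ 2 * jS (moebW z ^ 2)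

/-- Termwise geometric domination `‖m_j uʲ‖ ≤ 19‖u‖ʲ`. -/
theorem norm_ksMoment_mul_pow_le (j : ℕ) (u : ℂ) :
    ‖(ksMoment j : ℂ) * u ^ j‖ ≤ 19 * ‖u‖ ^ j := by
  rw [norm_mul, norm_pow, Complex.norm_real, Real.norm_eq_abs]
  exact mul_le_mul_of_nonneg_right (abs_ksMoment_le' j) (pow_nonneg (norm_nonneg _) _)

/-- Absolute convergence of the series of `jS` on the open unit disc. -/
theorem summable_norm_jS_term {u : ℂ} (hu : ‖u‖ < 1) :
    Summable fun j : ℕ => ‖(ksMoment j : ℂ) * u ^ j‖ :=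
  Summable.of_nonneg_of_le (fun _ => norm_nonneg _) (fun j => norm_ksMoment_mul_pow_le j u)
    ((summable_geometric_of_lt_one (norm_nonneg _) hu).mul_left 19)

/-- `jS u = Σ_j m_j uʲ` as a `HasSum`, `‖u‖ < 1`. -/
theorem jS_hasSum {u : ℂ} (hu : ‖u‖ < 1) :
    HasSum (fun j : ℕ => (ksMoment j : ℂ) * u ^ j) (jS u) :=
  (summable_norm_jS_term hu).of_norm.hasSum

/-- `jS` is analytic on the unit ball (power series with bounded coefficients). -/
theorem hasFPowerSeriesOnBall_jS :
    HasFPowerSeriesOnBall jS (FormalMultilinearSeries.ofScalars ℂ (fun j => (ksMoment j : ℂ))) 0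
      (ENNReal.ofReal 1) :=
  Literature.Analysis.TotalPositivity.hasFPowerSeriesOnBall_of_hasSum one_pos
    (fun _ hu => jS_hasSum hu)

/-- `jS` is complex-differentiable on the open unit disc. -/
theorem differentiableOn_jS : DifferentiableOn ℂ jS (Metric.ball (0 : ℂ) 1) := by
  have h := hasFPowerSeriesOnBall_jS.differentiableOn
  rwa [Metric.eball_ofReal] at h

/-- `‖w(z)‖ ≤ r/(2−r)` when `‖z‖ ≤ r < 2` (`|2 − z| ≥ 2 − |z|`). -/
theorem norm_moebW_le {z : ℂ} {r : ℝ} (hz : ‖z‖ ≤ r) (hr : r < 2) :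
    ‖moebW z‖ ≤ r / (2 - r) := by
  unfold moebW
  have h2z : 2 - r ≤ ‖(2 : ℂ) - z‖ := by
    have := norm_sub_norm_le (2 : ℂ) z
    have h2 : ‖(2 : ℂ)‖ = 2 := by simp
    linarith
  have hpos : 0 < 2 - r := by linarith
  rw [norm_div, div_le_div_iff₀ (lt_of_lt_of_le hpos h2z) hpos]
  have hz0 : 0 ≤ ‖z‖ := norm_nonneg z
  nlinarith

/-- `‖w(z)‖ < 1` on the open unit disc (indeed on `Re z < 1`; the disc suffices here). -/
theorem norm_moebW_lt_one {z : ℂ} (hz : ‖z‖ < 1) : ‖moebW z‖ < 1 := by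
  have h := norm_moebW_le (le_refl ‖z‖) (by linarith)
  refine lt_of_le_of_lt h ?_
  rw [div_lt_one (by linarith)]
  linarith

/-- `w` is complex-differentiable on the open unit disc. -/
theorem differentiableOn_moebW : DifferentiableOn ℂ moebW (Metric.ball (0 : ℂ) 1) := by
  unfold moebW
  refine DifferentiableOn.div differentiableOn_id (by fun_prop) ?_
  intro z hz
  rw [Metric.mem_ball, dist_zero_right] at hz
  intro h
  have : ‖(2 : ℂ) - z‖ = 0 := by rw [h, norm_zero]
  have h2 := norm_sub_norm_le (2 : ℂ) z
  have h2' : ‖(2 : ℂ)‖ = 2 := by simp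
  linarith

/-- **`J₄` is complex-differentiable on the open unit disc** (gl_bounds.md §2.1). -/
theorem differentiableOn_jC : DifferentiableOn ℂ jC (Metric.ball (0 : ℂ) 1) := by
  have hw2 : DifferentiableOn ℂ (fun z => moebW z ^ 2) (Metric.ball (0 : ℂ) 1) :=
    differentiableOn_moebW.pow 2
  have hmaps : MapsTo (fun z => moebW z ^ 2) (Metric.ball (0 : ℂ) 1) (Metric.ball (0 : ℂ) 1) := by
    intro z hz
    rw [Metric.mem_ball, dist_zero_right] at hz ⊢
    rw [norm_pow]
    have h := norm_moebW_lt_one hz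
    have h0 : 0 ≤ ‖moebW z‖ := norm_nonneg _
    nlinarith
  unfold jC
  exact hw2.mul (differentiableOn_jS.comp hw2 hmaps)

/-- **`jC` extends `J₄`**: for `0 < x < 1`, `jC x = ∫₀¹ ρ₄(t)/W_t(x) dt`. -/
theorem jC_ofReal {x : ℝ} (hx0 : 0 < x) (hx1 : x < 1) :
    jC (x : ℂ) = ((∫ t in (0:ℝ)..1, rho4 t / wt t x 1 : ℝ) : ℂ) := by
  have h2x : 0 < 2 - x := by linarith
  have hw : moebW (x : ℂ) = ((x / (2 - x) : ℝ) : ℂ) := by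
    unfold moebW; push_cast; rfl
  have hwlt : x / (2 - x) < 1 := by rw [div_lt_one h2x]; linarith
  have hw0 : 0 ≤ x / (2 - x) := div_nonneg hx0.le h2x.le
  have hu : ‖moebW (x : ℂ) ^ 2‖ < 1 := by
    rw [hw, norm_pow, Complex.norm_real, Real.norm_eq_abs, abs_of_nonneg hw0]
    nlinarith
  have h1 : HasSum (fun j : ℕ => moebW (x : ℂ) ^ 2 * ((ksMoment j : ℂ) * (moebW (x : ℂ) ^ 2) ^ j))
      (jC (x : ℂ)) := (jS_hasSum hu).mul_left _
  have h2 : HasSum (fun j : ℕ => ((ksMoment j * (x / (2 - x)) ^ (2 * j + 2) : ℝ) : ℂ))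
      ((∫ t in (0:ℝ)..1, rho4 t / wt t x 1 : ℝ) : ℂ) :=
    Complex.ofRealCLM.hasSum (hasSum_integral_rho4_div_wt hx0 hx1)
  have h3 : (fun j : ℕ => ((ksMoment j * (x / (2 - x)) ^ (2 * j + 2) : ℝ) : ℂ))
      = fun j : ℕ => moebW (x : ℂ) ^ 2 * ((ksMoment j : ℂ) * (moebW (x : ℂ) ^ 2) ^ j) := by
    funext j
    rw [hw]
    push_cast
    rw [← pow_mul, show 2 * j + 2 = 2 * j + 2 from rfl]
    ring
  rw [h3] at h2
  exact h1.unique h2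

/-! ### The majorant `𝒥(r) = Γ·u·atanh u`, `u = r/(2−r)` -/

/-- gl_bounds.md §2.4's `𝒥(r) := Γ·u·atanh(u)`, `u = r/(2−r)`, `Γ = 19`, with `atanh u` written as
`(ln(1+u) − ln(1−u))/2`. -/
def jMaj (r : ℝ) : ℝ :=
  19 * (r / (2 - r)) * ((Real.log (1 + r / (2 - r)) - Real.log (1 - r / (2 - r))) / 2)

/-- The majorant series: for `0 ≤ u < 1`, `Σ_j 19 u^{2j+2}/(2j+1) = 19·u·(ln(1+u) − ln(1−u))/2`. -/
theorem hasSum_jMaj_series {u : ℝ} (hu0 : 0 ≤ u) (hu1 : u < 1) :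
    HasSum (fun j : ℕ => 19 / (2 * (j : ℝ) + 1) * u ^ (2 * j + 2))
      (19 * u * ((Real.log (1 + u) - Real.log (1 - u)) / 2)) := by
  have habs : |u| < 1 := by rw [abs_of_nonneg hu0]; exact hu1
  have h := (Real.hasSum_log_sub_log_of_abs_lt_one habs).mul_left (19 * u / 2)
  have hv : 19 * u / 2 * (Real.log (1 + u) - Real.log (1 - u))
      = 19 * u * ((Real.log (1 + u) - Real.log (1 - u)) / 2) := by ring
  rw [hv] at h
  refine h.congr_fun fun j => ?_
  have : (2 * (j : ℝ) + 1) ≠ 0 := by positivity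
  field_simp
  ring

/-- **The majorant of gl_bounds.md §2.4**: `‖z‖ ≤ r < 1 ⇒ ‖J₄(z)‖ ≤ 𝒥(r)`. -/
theorem norm_jC_le {z : ℂ} {r : ℝ} (hz : ‖z‖ ≤ r) (hr : r < 1) : ‖jC z‖ ≤ jMaj r := by
  have hr0 : 0 ≤ r := (norm_nonneg z).trans hz
  set u := r / (2 - r) with hu
  have hu0 : 0 ≤ u := div_nonneg hr0 (by linarith)
  have hu1 : u < 1 := by rw [hu, div_lt_one (by linarith)]; linarith
  have hwu : ‖moebW z‖ ≤ u := norm_moebW_le hz (by linarith)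
  have hw1 : ‖moebW z ^ 2‖ < 1 := by
    rw [norm_pow]
    have h0 : 0 ≤ ‖moebW z‖ := norm_nonneg _
    nlinarith
  -- jC z = Σ_j m_j (w²)^j · w²
  have hser : HasSum (fun j : ℕ => (ksMoment j : ℂ) * (moebW z ^ 2) ^ j * moebW z ^ 2) (jC z) := by
    have h := (jS_hasSum hw1).mul_right (moebW z ^ 2)
    have e : jS (moebW z ^ 2) * moebW z ^ 2 = jC z := by unfold jC; ring
    rwa [e] at h
  have hnorm : ∀ j : ℕ, ‖(ksMoment j : ℂ) * (moebW z ^ 2) ^ j * moebW z ^ 2‖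
      ≤ 19 / (2 * (j : ℝ) + 1) * u ^ (2 * j + 2) := by
    intro j
    rw [norm_mul, norm_mul, norm_pow, norm_pow, Complex.norm_real, Real.norm_eq_abs, ← pow_mul]
    have e : |ksMoment j| * ‖moebW z‖ ^ (2 * j) * ‖moebW z‖ ^ 2
        = |ksMoment j| * ‖moebW z‖ ^ (2 * j + 2) := by ring
    rw [e]
    have h1 : ‖moebW z‖ ^ (2 * j + 2) ≤ u ^ (2 * j + 2) :=
      pow_le_pow_left₀ (norm_nonneg _) hwu _
    have h2 := abs_ksMoment_le j
    have h3 : 0 ≤ 19 / (2 * (j : ℝ) + 1) := by positivity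
    calc |ksMoment j| * ‖moebW z‖ ^ (2 * j + 2)
        ≤ 19 / (2 * (j : ℝ) + 1) * ‖moebW z‖ ^ (2 * j + 2) :=
          mul_le_mul_of_nonneg_right h2 (pow_nonneg (norm_nonneg _) _)
      _ ≤ 19 / (2 * (j : ℝ) + 1) * u ^ (2 * j + 2) := mul_le_mul_of_nonneg_left h1 h3
  have hM := hasSum_jMaj_series hu0 hu1
  have hsN : Summable fun j : ℕ => ‖(ksMoment j : ℂ) * (moebW z ^ 2) ^ j * moebW z ^ 2‖ :=
    Summable.of_nonneg_of_le (fun _ => norm_nonneg _) hnorm hM.summable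
  have hval : 19 * u * ((Real.log (1 + u) - Real.log (1 - u)) / 2) = jMaj r := by
    simp only [jMaj, hu]
  calc ‖jC z‖ = ‖∑' j : ℕ, (ksMoment j : ℂ) * (moebW z ^ 2) ^ j * moebW z ^ 2‖ := by rw [hser.tsum_eq]
    _ ≤ ∑' j : ℕ, ‖(ksMoment j : ℂ) * (moebW z ^ 2) ^ j * moebW z ^ 2‖ := norm_tsum_le_tsum_norm hsN
    _ ≤ ∑' j : ℕ, 19 / (2 * (j : ℝ) + 1) * u ^ (2 * j + 2) := hsN.tsum_le_tsum hnorm hM.summable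
    _ = jMaj r := by rw [hM.tsum_eq, hval]

/-- `𝒥(r) ≥ 0` for `0 ≤ r < 1` (it dominates a norm). -/
theorem jMaj_nonneg {r : ℝ} (hr0 : 0 ≤ r) (hr : r < 1) : 0 ≤ jMaj r := by
  have h := norm_jC_le (z := (r : ℂ)) (by rw [Complex.norm_real, Real.norm_eq_abs, abs_of_nonneg hr0]) hr
  exact (norm_nonneg _).trans h

/-- Real corollary: for `0 < x < 1`, `|J₄(x)| ≤ 𝒥(x)`. -/
theorem abs_integral_rho4_div_wt_le_jMaj {x : ℝ} (hx0 : 0 < x) (hx1 : x < 1) :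
    |∫ t in (0:ℝ)..1, rho4 t / wt t x 1| ≤ jMaj x := by
  have hxn : ‖(x : ℂ)‖ = x := by rw [Complex.norm_real, Real.norm_eq_abs, abs_of_pos hx0]
  have h := norm_jC_le (z := (x : ℂ)) (le_of_eq hxn) hx1
  rwa [jC_ofReal hx0 hx1, Complex.norm_real, Real.norm_eq_abs] at h

end Summit.Ventures.QEDPrecision.SpectralMajorants

end
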